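import Literature.AlgebraicGeometry.Resolution.KnafKuhlmann2009Lemma21
import Literature.AlgebraicGeometry.Resolution.KnafKuhlmann2009Prop23
import Literature.AlgebraicGeometry.Resolution.SeparableClosureValuation
import Mathlib.FieldTheory.IsSepClosed
import Mathlib.RingTheory.AlgebraicIndependent.AlgebraicClosure
import HarnessLib

/-!
# Knaf–Kuhlmann 2009, Thm. 1.1 from Prop. 3.10: the induction of §4.1

Topic: `Literature/AlgebraicGeometry/Resolution`. A layer of the decomposition of the named fact
`KnafKuhlmann2009` (`LocalUniformization.lean`; Knaf–Kuhlmann 2009, Thm. 1.2). After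
`AbhyankarEtaleAscent.lean` its frontier was `{KnafKuhlmann2009_Thm11, KnafKuhlmann2005_Thm34_etale}`
(`KnafKuhlmann2009.of_parts''`). This file PROVES

* `KnafKuhlmann2009_Thm11.of_prop310 : KnafKuhlmann2009_Prop310_sepClosed → KnafKuhlmann2009_Thm11`,

i.e. Knaf–Kuhlmann 2009, Thm. 1.1 (existence part, as vendored in
`FiniteExtensionUniformization.lean`) from the single named fact
`KnafKuhlmann2009_Prop310_sepClosed` of `KnafKuhlmann2009Thm11Parts.lean` (Prop. 3.10 over a
separable-algebraically closed ground field = F.-V. Kuhlmann's henselian rationality [K8] +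
Kaplansky approximation), everything else in §4.1 being proved here or earlier in the topic
(Lemma 2.1: `SeparableClosureValuation.lean`, `KnafKuhlmann2009Lemma21.lean`; Prop. 3.2 in the
strong form `knafKuhlmann2009_prop32_adjoin` and Prop. 3.4 (2):
`FiniteExtensionUniformizationProofs.lean`). The frontier of `KnafKuhlmann2009` thereby becomes
`{KnafKuhlmann2009_Prop310_sepClosed, KnafKuhlmann2005_Thm34_etale}` — the two theorems of
Kuhlmann's ramification theory (henselian rationality; generalized stability / inertial
generation) on which the paper rests.

## Content

* `exists_model_over_separableClosure` — the case `n = 1` of §4.1 relative to a subfield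
  `E₀ ≤ E` of codimension one (separating element `t₁`): with `L := E₀^{sep}`, `(E.L | L)` is an
  immediate function field of transcendence degree `1` over the separably closed `L` (Lemma 2.1;
  the place is non-trivial on `K` by `exists_mem_not_mem_valuationSubring`), so Prop. 3.10 gives an
  `O_L`-model of `E.L` smooth at the centre with every `z ∈ Z` written `z = u z'`, `u` a unit at the
  centre, `z' ∈ O_L` (immediateness of the value group).
* `knafKuhlmann2009_thm11_sepClosed` — **Thm. 1.1 over a separably closed ground field `K`**, by
  induction on the number of elements of a separating transcendence basis `t`: no extension of the
  ground field is needed (`𝒦 = K`), the conclusion being a finite separable `𝓔 ⊇ E` with an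
  `O_K`-model smooth at the centre and factorizations `z = (a/b) z'`, `z' ∈ O_K`. Case `n = 0`:
  `E = K` and the model is `O_K` (`exists_model_bot`). Step (§4.1, pp. 20–22, reorganised): split
  `t = T₀ ∪ {t₁}`, `E₀ := K(T₀)`, `L := E₀^{sep}`; the engine gives an `O_L`-model `A` of `E.L`;
  Prop. 3.2 gives `S₀ ⊆ O_L` and `G ⊆ A_q` such that `S'[G]` is a model over every `S' ⊆ O_L`
  containing `S₀`; the induction hypothesis for `ℰ₀ := K(T₀, S₀, Z') ⊆ L` gives a finite separable
  `ℰ₁ ⊇ ℰ₀` (hence `ℰ₁ ⊆ L`) and an `O_K`-model `B` of `ℰ₁` with `S₀ ∪ Z'` in its local ring,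
  improved to an everywhere smooth `B₂ ⊇ S₀ ∪ Z'` (`exists_smooth_model_over`); descent to
  `S' := B₂` gives `C := B₂[G]`, finitely presented over `B₂` and smooth at the centre, hence so
  over `O_K` (`finitePresentation_restrictScalars`, `isSmoothAt_centre_restrictScalars`), and
  `𝓔 := Frac C ⊇ E` is finite separable over `E`.
* `KnafKuhlmann2009_Thm11.of_prop310` — **Thm. 1.1**: over `K' := K^{sep}` the extension
  `E' := E.K'` still satisfies the hypotheses (`vE'/vK'` is even trivial and `E'P|K'P` algebraic,
  Lemma 2.1; algebraic independence extends along the algebraic `K'|K`); the previous theorem gives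
  `𝓔' ⊇ E'` and an `O_{K'}`-model with factorizations `z = u z'`, `z' ∈ O_{K'}`; Prop. 3.4 (2),
  applied over `k₁ := K(Z')` to the field `F₁` generated by `Z`, the units `u`, generators of the
  model and of `E`, descends the model to `O_𝒦` for a finitely generated — hence finite — `𝒦|K`
  inside `K'` containing the `z'`; `𝓔 := F₁.𝒦` is finite separable over `E`.

## Design note

The printed §4.1 runs the induction over `K` itself; the induction hypothesis then enlarges the
ground field (`𝒦`, `ℰ₁`) and the model of `E.ℰ₀` over `O_{ℰ₀}` has to be moved to the new base
by descent to `B ∩ ℰ₀` (Prop. 3.2) followed by ASCENT along `B ∩ ℰ₀ ⊆ B` (Prop. 3.3, standard-smooth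
presentations and Gauß' lemma). Over a separably closed ground field the induction hypothesis
produces no constant extension and the model `B` of `ℰ₁ ⊆ L = E₀^{sep}` lies inside the base
`O_L` of the engine's model, so the strong form of Prop. 3.2 (descent to an ARBITRARY subring
`S' ⊇ S₀` of `O_L`, no normality) does the stacking by itself and Prop. 3.3 is not needed; the
single descent from `K^{sep}` to a finite `𝒦|K` is Prop. 3.4 (2). The statement proved is the
vendored `KnafKuhlmann2009_Thm11` verbatim.

## Sources

* [KK09] H. Knaf, F.-V. Kuhlmann, *Every place admits local uniformization in a finite extension
  of the function field*, Adv. Math. 221 (2009) 428–453 = arXiv:math/0702856: Thm. 1.1 (p. 4 of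
  the arXiv PDF), Lemma 2.1 (p. 7), Prop. 3.2, Prop. 3.4 (pp. 11–12), Prop. 3.10 (p. 14), §4.1
  (pp. 16–17: proof of Thm. 1.1, "Uniformization after a Galois extension": case `n = 1` and the
  induction step). Page numbers are those of the 19-page arXiv PDF as served by `lit read`.
* [K8] F.-V. Kuhlmann, *Elimination of ramification II: Henselian rationality*, Israel J. Math.
  234 (2019) 927–958 (the source of Prop. 3.10 via Thm. 3.8; not used directly).

## Rendering notes

Ambient rendering of `ValuedFunctionFields.lean` / `FiniteExtensionUniformization.lean`: one
algebraically closed valued field `(Ω, V)`, subfields of `Ω`, `O_E = V ∩ E` as the subring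
`V.toSubring ⊓ E.toSubring`, `K^{sep} = (separableClosure K Ω).toSubfield`, models as subalgebras
`A ⊆ V` with `Frac A = E` rendered `∀ x ∈ E, ∃ a b ∈ A, x = a / b`, smoothness at the centre
`Algebra.IsSmoothAt _ (centre A V _)`, "`z ∈ A_q`" as `z = a / b`, `v(b) = 1`, and a unit of `A_q` as
`a / b` with `v(a) = v(b) = 1`.
-/

noncomputable section

namespace Literature.AlgebraicGeometry.Resolution

universe u

open IsLocalRing

variable {Ω : Type u} [Field Ω]

/-! ## Separably closed subfields and relative separable closures -/

/-- An element of `Ω` separable over a separably closed subfield `K` lies in `K`. [folklore] -/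
theorem mem_of_isSeparable_of_isSepClosed (K : Subfield Ω) [IsSepClosed K] {x : Ω}
    (hx : IsSeparable K x) : x ∈ K := by
  haveI : Algebra.IsSeparable K (IntermediateField.adjoin K ({x} : Set Ω)) :=
    (IntermediateField.isSeparable_adjoin_simple_iff_isSeparable K Ω).mpr hx
  obtain ⟨c, hc⟩ := IsSepClosed.algebraMap_surjective K (IntermediateField.adjoin K ({x} : Set Ω))
    ⟨x, IntermediateField.mem_adjoin_simple_self K x⟩
  have hcx : (c : Ω) = x := by
    have := congrArg (fun t : IntermediateField.adjoin K ({x} : Set Ω) => (t : Ω)) hc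
    exact this
  rw [← hcx]
  exact c.2

/-- The relative separable closure of a subfield `K` in an algebraically closed `Ω` is a
separably closed field. [folklore] -/
theorem isSepClosed_toSubfield_separableClosure [IsAlgClosed Ω] (K : Subfield Ω) :
    IsSepClosed (separableClosure K Ω).toSubfield := by
  haveI : IsSepClosure K (separableClosure K Ω) := separableClosure.isSepClosure _ _
  have h : IsSepClosed (separableClosure K Ω) := IsSepClosure.sep_closed K
  exact h

/-- An element separable over `K^{sep}` lies in `K^{sep}` (`Ω` algebraically closed).
[folklore] -/
theorem mem_separableClosure_of_isSeparable_separableClosure [IsAlgClosed Ω] (K : Subfield Ω)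
    {x : Ω} (hx : IsSeparable (separableClosure K Ω).toSubfield x) :
    x ∈ (separableClosure K Ω).toSubfield :=
  haveI := isSepClosed_toSubfield_separableClosure K
  mem_of_isSeparable_of_isSepClosed _ hx

/-- `K^{sep} ⊆ E^{sep}` for `K ≤ E`. [folklore] -/
theorem toSubfield_separableClosure_mono {K E : Subfield Ω} (hKE : K ≤ E) :
    (separableClosure K Ω).toSubfield ≤ (separableClosure E Ω).toSubfield := fun x hx => by
  rw [mem_toSubfield_separableClosure_iff] at hx ⊢
  exact isSeparable_of_subfield_le hKE hx

/-- Every element of `E ⊔ K^{sep}` is separable over `E ⊇ K`. [folklore] -/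
theorem isSeparable_of_mem_sup_separableClosure {K E : Subfield Ω} (hKE : K ≤ E) {x : Ω}
    (hx : x ∈ E ⊔ (separableClosure K Ω).toSubfield) : IsSeparable E x := by
  have hcl : Subfield.closure ((E : Set Ω) ∪ ((separableClosure K Ω).toSubfield : Set Ω)) =
      E ⊔ (separableClosure K Ω).toSubfield := by
    rw [closure_union_eq_sup, Subfield.closure_eq]
  rw [← hcl] at hx
  refine isSeparable_of_mem_closure (fun y hy => ?_) hx
  exact isSeparable_of_subfield_le hKE ((mem_toSubfield_separableClosure_iff K).mp hy)

/-- A finite separable extension of a subfield of `K^{sep}` containing `K` stays inside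
`K^{sep}`. [folklore] -/
theorem le_separableClosure_of_finiteSeparableOver [IsAlgClosed Ω] {K M N : Subfield Ω}
    (hM : M ≤ (separableClosure K Ω).toSubfield) (hMN : FiniteSeparableOver M N) :
    N ≤ (separableClosure K Ω).toSubfield := by
  obtain ⟨s, hs, hsN⟩ := hMN
  rw [← hsN]
  refine Subfield.closure_le.mpr (Set.union_subset hM fun x hx => ?_)
  refine mem_separableClosure_of_isSeparable_separableClosure K ?_
  exact isSeparable_of_subfield_le hM (hs x hx)

/-! ## Value groups and residue fields along algebraic extensions -/

/-- `vF/vK` is torsion for `F` algebraic over `K`. [folklore] -/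
theorem isValueTorsionOver_of_isAlgebraic (V : ValuationSubring Ω) {K F : Subfield Ω}
    (halg : ∀ x ∈ F, IsAlgebraic K x) : IsValueTorsionOver V K F :=
  fun a ha ha0 => exists_valuation_pow_eq_of_isAlgebraic V (halg a ha) ha0

/-- `FP|KP` is algebraic for `F` algebraic over `K`. [folklore] -/
theorem isResiduallyAlgebraicOver_of_isAlgebraic (V : ValuationSubring Ω) {K F : Subfield Ω}
    (halg : ∀ x ∈ F, IsAlgebraic K x) : IsResiduallyAlgebraicOver V K F := by
  intro r hr
  obtain ⟨a, haF, rfl⟩ := (mem_resField_iff V F r).mp hr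
  have := isAlgebraic_residue_of_isAlgebraic V a.2 (halg a haF)
  exact this

/-- `IsValueTorsionOver` is monotone in the top field. [folklore] -/
theorem IsValueTorsionOver.mono_right {V : ValuationSubring Ω} {K F F' : Subfield Ω}
    (h : IsValueTorsionOver V K F) (hF : F' ≤ F) : IsValueTorsionOver V K F' :=
  fun a ha ha0 => h a (hF ha) ha0

/-- `IsValueTorsionOver` is monotone in the bottom field. [folklore] -/
theorem IsValueTorsionOver.mono_left {V : ValuationSubring Ω} {K K' F : Subfield Ω}
    (h : IsValueTorsionOver V K F) (hK : K ≤ K') : IsValueTorsionOver V K' F := by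
  intro a ha ha0
  obtain ⟨n, hn, b, hb, hab⟩ := h a ha ha0
  exact ⟨n, hn, b, hK hb, hab⟩

/-- `IsResiduallyAlgebraicOver` is monotone in the top field. [folklore] -/
theorem IsResiduallyAlgebraicOver.mono_right {V : ValuationSubring Ω} {K F F' : Subfield Ω}
    (h : IsResiduallyAlgebraicOver V K F) (hF : F' ≤ F) : IsResiduallyAlgebraicOver V K F' :=
  fun r hr => h r (resField_mono V hF hr)

/-- `IsResiduallyAlgebraicOver` is monotone in the bottom field. [folklore] -/
theorem IsResiduallyAlgebraicOver.mono_left {V : ValuationSubring Ω} {K K' F : Subfield Ω}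
    (h : IsResiduallyAlgebraicOver V K F) (hK : K ≤ K') : IsResiduallyAlgebraicOver V K' F :=
  fun r hr => isAlgebraic_of_subfield_le (resField_mono V hK) (h r hr)

/-- `IsResiduallyAlgebraicOver` is transitive. [folklore] -/
theorem IsResiduallyAlgebraicOver.trans {V : ValuationSubring Ω} {K F L : Subfield Ω}
    (hKF : K ≤ F) (h₁ : IsResiduallyAlgebraicOver V K F) (h₂ : IsResiduallyAlgebraicOver V F L) :
    IsResiduallyAlgebraicOver V K L :=
  fun r hr => isAlgebraic_trans_subfield (resField_mono V hKF) h₁ (h₂ r hr)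

/-- The hypotheses "`vE/vK` torsion, `EP|KP` algebraic" pass from `E` to `E^{sep}`.
[folklore] -/
theorem isValueTorsionOver_separableClosure {V : ValuationSubring Ω} {K E : Subfield Ω}
    (htor : IsValueTorsionOver V K E) :
    IsValueTorsionOver V K (separableClosure E Ω).toSubfield := by
  have h : IsValueTorsionOver V E (separableClosure E Ω).toSubfield :=
    isValueTorsionOver_of_isAlgebraic V fun x hx =>
      ((mem_toSubfield_separableClosure_iff E).mp hx).isIntegral.isAlgebraic
  exact htor.trans h

/-- Idem for residue fields. [folklore] -/
theorem isResiduallyAlgebraicOver_separableClosure {V : ValuationSubring Ω} {K E : Subfield Ω}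
    (hKE : K ≤ E) (hres : IsResiduallyAlgebraicOver V K E) :
    IsResiduallyAlgebraicOver V K (separableClosure E Ω).toSubfield := by
  have h : IsResiduallyAlgebraicOver V E (separableClosure E Ω).toSubfield :=
    isResiduallyAlgebraicOver_of_isAlgebraic V fun x hx =>
      ((mem_toSubfield_separableClosure_iff E).mp hx).isIntegral.isAlgebraic
  exact hres.trans hKE h

/-! ## Non-triviality of the place -/

/-- If `vE/vK` is torsion, `EP|KP` is algebraic and `E` contains an element transcendental over
`K`, then the place is non-trivial on `K`: some element of `K` lies outside `V` (otherwise
`E ⊆ V` by torsion-freeness of the value group, and residues of elements of `E ⊆ V`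
transcendental over `K` are transcendental over `KP`). [folklore] -/
theorem exists_mem_not_mem_valuationSubring {V : ValuationSubring Ω} {K E : Subfield Ω}
    (hKE : K ≤ E) (htor : IsValueTorsionOver V K E) (hres : IsResiduallyAlgebraicOver V K E)
    {x : Ω} (hxE : x ∈ E) (hx : Transcendental K x) : ∃ a ∈ K, a ∉ V := by
  by_contra hcon
  push Not at hcon
  -- `E ⊆ V`
  have hEV : ∀ e ∈ E, e ∈ V := by
    intro e he
    by_cases he0 : e = 0
    · rw [he0]; exact V.zero_mem
    obtain ⟨n, hn, b, hbK, hb⟩ := htor e he he0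
    have hb0 : b ≠ 0 := by
      rintro rfl
      rw [map_zero, map_pow, pow_eq_zero_iff hn, map_eq_zero] at hb
      exact he0 hb
    have hvb : V.valuation b = 1 := valuation_eq_one_of_subfield_subset V hcon hbK hb0
    have h1 : V.valuation e ^ n = (1 : _) ^ n := by rw [one_pow, ← hvb, ← map_pow, hb]
    have hve : V.valuation e = 1 := (pow_left_strictMonoOn₀ hn).injOn zero_le zero_le h1
    exact (V.valuation_le_one_iff e).mp hve.le
  -- residues of `E` are algebraically independent images
  have hind : AlgebraicIndependent K (fun _ : Fin 1 => x) :=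
    algebraicIndependent_unique_type_iff.mpr hx
  have hind' := algebraicIndependent_residue_of_subset V K hKE hEV (fun _ : Fin 1 => x)
    (fun _ => hxE) hind
  have htrans : Transcendental (resField V K) (residue V ⟨x, hEV x hxE⟩) :=
    algebraicIndependent_unique_type_iff.mp hind'
  exact htrans (hres _ (residue_mem_resField V ⟨x, hEV x hxE⟩ hxE))


/-! ## The trivial model of a subfield over its own valuation ring -/

/-- Over its own valuation ring `O_K = V ∩ K` a subfield `K` has the trivial model `A = O_K`
(the bottom subalgebra): finitely presented, `Frac A = K`, smooth at the centre (a
localisation), and every `z ∈ V ∩ K` factors as `z = (1/1) · z`. [folklore] -/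
theorem exists_model_bot (V : ValuationSubring Ω) (K : Subfield Ω) (Z : Finset Ω)
    (hZ : ∀ z ∈ Z, z ∈ V ∧ z ∈ K) :
    ∃ (A : Subalgebra ↥(V.toSubring ⊓ K.toSubring) Ω) (hAV : A.toSubring ≤ V.toSubring),
      (A : Set Ω) ⊆ K ∧ Algebra.FinitePresentation ↥(V.toSubring ⊓ K.toSubring) A ∧
      (∀ x ∈ K, ∃ a ∈ A, ∃ b ∈ A, x = a / b) ∧
      Algebra.IsSmoothAt ↥(V.toSubring ⊓ K.toSubring) (centre A V hAV) ∧
      ∀ z ∈ Z, ∃ a ∈ A, ∃ b ∈ A, ∃ z' ∈ K, z' ∈ V ∧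
        V.valuation a = 1 ∧ V.valuation b = 1 ∧ z = a / b * z' := by
  set O : Subring Ω := V.toSubring ⊓ K.toSubring with hOdef
  let A : Subalgebra O Ω := ⊥
  have hmemA : ∀ {x : Ω}, x ∈ A ↔ x ∈ V ∧ x ∈ K := by
    intro x
    rw [Algebra.mem_bot]
    constructor
    · rintro ⟨c, rfl⟩
      exact c.2
    · intro hx
      exact ⟨⟨x, hx⟩, rfl⟩
  have hAV : A.toSubring ≤ V.toSubring := fun x hx => (hmemA.mp hx).1
  have hinj : Function.Injective (algebraMap O Ω) := Subtype.coe_injective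
  let e : A ≃ₐ[O] O := Algebra.botEquivOfInjective hinj
  refine ⟨A, hAV, fun x hx => (hmemA.mp hx).2, Algebra.FinitePresentation.equiv e.symm, ?_, ?_, ?_⟩
  · intro x hx
    rcases V.mem_or_inv_mem x with h | h
    · exact ⟨x, hmemA.mpr ⟨h, hx⟩, 1, one_mem A, by rw [div_one]⟩
    · refine ⟨1, one_mem A, x⁻¹, hmemA.mpr ⟨h, inv_mem hx⟩, ?_⟩
      rw [one_div, inv_inv]
  · -- smooth at the centre: `O ≃ A → A_q` is a localisation
    set q := centre A V hAV with hq
    haveI : Algebra.FormallySmooth O A := Algebra.FormallySmooth.of_equiv e.symm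
    haveI : Algebra.FormallySmooth A (Localization.AtPrime q) :=
      Algebra.FormallySmooth.of_isLocalization q.primeCompl
    have : Algebra.FormallySmooth O (Localization.AtPrime q) :=
      Algebra.FormallySmooth.comp O A (Localization.AtPrime q)
    exact this
  · intro z hz
    exact ⟨1, one_mem A, 1, one_mem A, z, (hZ z hz).2, (hZ z hz).1, map_one _, map_one _,
      by rw [div_one, one_mul]⟩

/-! ## Improving a model to an everywhere smooth one containing finitely many given elements -/

section SmoothModel

variable {R : Type*} [CommRing R] [Algebra R Ω]

/-- `B[1/f]` is smooth over `R` if `B` is. [folklore] -/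
theorem smooth_locAway_of_smooth {B : Subalgebra R Ω} {f : Ω} {hf : f ∈ B} (hf0 : f ≠ 0)
    [Algebra.Smooth R B] : Algebra.Smooth R (locAway B f hf) := by
  letI := (Subalgebra.inclusion (le_locAway (B := B) (f := f) (hf := hf))).toRingHom.toAlgebra
  haveI : IsScalarTower R B (locAway B f hf) := IsScalarTower.of_algebraMap_eq fun _ => rfl
  haveI := isLocalization_locAway (B := B) (hf := hf) hf0
  haveI : Algebra.FormallySmooth R (locAway B f hf) := formallySmooth_locAway hf0
  haveI : Algebra.FinitePresentation B (locAway B f hf) :=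
    IsLocalization.Away.finitePresentation (⟨f, hf⟩ : B)
  haveI : Algebra.FinitePresentation R (locAway B f hf) :=
    Algebra.FinitePresentation.trans R B (locAway B f hf)
  exact ⟨inferInstance, inferInstance⟩

/-- From a model `B ⊆ V ∩ E` over `R`, finitely presented and smooth over `R` at the centre,
with `Z₁ ⊆ B_q`, pass to `B₂ := B[1/f][1/d] ⊆ V ∩ E`: smooth over `R` everywhere, containing
`Z₁`, with the same fraction field, and contained in `B_q`. [folklore] -/
theorem exists_smooth_model_over {V : ValuationSubring Ω} {E : Subfield Ω} (B : Subalgebra R Ω)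
    (hBV : B.toSubring ≤ V.toSubring) (hBE : (B : Set Ω) ⊆ E) [Algebra.FinitePresentation R B]
    (hsm : Algebra.IsSmoothAt R (centre B V hBV)) (hfrac : ∀ x ∈ E, ∃ a ∈ B, ∃ b ∈ B, x = a / b)
    (Z₁ : Finset Ω) (hZ : ∀ z ∈ Z₁, ∃ a ∈ B, ∃ b ∈ B, V.valuation b = 1 ∧ z = a / b) :
    ∃ (B₂ : Subalgebra R Ω), B₂.toSubring ≤ V.toSubring ∧ (B₂ : Set Ω) ⊆ E ∧
      Algebra.Smooth R B₂ ∧ (Z₁ : Set Ω) ⊆ B₂ ∧ B ≤ B₂ ∧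
      (∀ x ∈ E, ∃ a ∈ B₂, ∃ b ∈ B₂, x = a / b) ∧
      ∀ x ∈ B₂, ∃ a ∈ B, ∃ b ∈ B, V.valuation b = 1 ∧ x = a / b := by
  classical
  haveI : Algebra.IsSmoothAt R (centre B V hBV) := hsm
  -- Step 1: `B₁ := B[1/f]` smooth everywhere
  obtain ⟨f, hfq, hfsm⟩ := Algebra.IsSmoothAt.exists_notMem_smooth R (centre B V hBV)
  have hvf : V.valuation (f : Ω) = 1 := by
    have h1 : V.valuation (f : Ω) ≤ 1 := (V.valuation_le_one_iff _).mpr (hBV f.2)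
    have h2 : ¬ V.valuation (f : Ω) < 1 := fun hlt => hfq ((mem_centre_iff B V hBV f).mpr hlt)
    exact le_antisymm h1 (not_lt.mp h2)
  have hf0 : (f : Ω) ≠ 0 := fun h0 => by simp [h0] at hvf
  let B₁ := locAway B (f : Ω) f.2
  haveI hsm₁ : Algebra.Smooth R B₁ := smooth_locAway hf0 (by simpa using hfsm)
  have hB₁V : B₁.toSubring ≤ V.toSubring := locAway_le_valuationSubring hBV hvf
  have hB₁E : (B₁ : Set Ω) ⊆ E := locAway_subset_subfield hBE hf0
  -- Step 2: `B₂ := B₁[1/d]`, `d` the product of the denominators of `Z₁`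
  choose a ha b hb hvb hab using hZ
  let d : Ω := ∏ w ∈ Z₁.attach, b w.1 w.2
  have hdB : d ∈ B := prod_mem fun w _ => hb w.1 w.2
  have hvd : V.valuation d = 1 := by
    change V.valuation (∏ w ∈ Z₁.attach, b w.1 w.2) = 1
    rw [map_prod]
    exact Finset.prod_eq_one fun w _ => hvb w.1 w.2
  have hd0 : d ≠ 0 := fun h0 => by simp [h0] at hvd
  let B₂ := locAway B₁ d (le_locAway hdB)
  haveI : Algebra.Smooth R B₂ := smooth_locAway_of_smooth hd0
  have hB₂V : B₂.toSubring ≤ V.toSubring := locAway_le_valuationSubring hB₁V hvd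
  have hB₂E : (B₂ : Set Ω) ⊆ E := locAway_subset_subfield hB₁E hd0
  refine ⟨B₂, hB₂V, hB₂E, inferInstance, ?_, fun x hx => le_locAway (le_locAway hx), ?_, ?_⟩
  · intro w hw
    refine ⟨1, ?_⟩
    rw [pow_one]
    have hw : w ∈ Z₁ := Finset.mem_coe.mp hw
    have hb0 : b w hw ≠ 0 := fun h0 => by simpa [h0] using hvb w hw
    have hwb : w * b w hw = a w hw := by
      have h := hab w hw
      calc w * b w hw = a w hw / b w hw * b w hw := by rw [← h]
        _ = a w hw := div_mul_cancel₀ _ hb0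
    have hprod := Finset.mul_prod_erase Z₁.attach (fun w' => b w'.1 w'.2)
      (Finset.mem_attach _ ⟨w, hw⟩)
    have hd : d = b w hw * ∏ w' ∈ Z₁.attach.erase ⟨w, hw⟩, b w'.1 w'.2 := hprod.symm
    rw [hd, ← mul_assoc, hwb]
    exact le_locAway (mul_mem (ha w hw) (prod_mem fun w' _ => hb w'.1 w'.2))
  · intro x hx
    obtain ⟨a', ha', b', hb', rfl⟩ := hfrac x hx
    exact ⟨a', le_locAway (le_locAway ha'), b', le_locAway (le_locAway hb'), rfl⟩
  · intro x hx
    obtain ⟨x₁, hx₁, n, rfl⟩ := (mem_locAway_iff_exists_div hd0).mp hx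
    obtain ⟨x₀, hx₀, m, rfl⟩ := (mem_locAway_iff_exists_div hf0).mp hx₁
    refine ⟨x₀, hx₀, (f : Ω) ^ m * d ^ n, mul_mem (pow_mem f.2 m) (pow_mem hdB n), ?_, ?_⟩
    · rw [map_mul, map_pow, map_pow, hvf, hvd, one_pow, one_pow, one_mul]
    · rw [div_div]

end SmoothModel

/-! ## A model over a smooth algebra is a model over the base -/

section Tower

variable {R : Type*} [CommRing R] [Algebra R Ω] (S : Type*) [CommRing S] [Algebra R S]
  [Algebra S Ω] [IsScalarTower R S Ω]

/-- A finitely presented algebra over a finitely presented `R`-algebra `S → Ω` is finitely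
presented over `R`. [folklore] -/
theorem finitePresentation_restrictScalars [Algebra.FinitePresentation R S]
    (C : Subalgebra S Ω) [Algebra.FinitePresentation S C] :
    Algebra.FinitePresentation R (C.restrictScalars R) := by
  have : Algebra.FinitePresentation R C := Algebra.FinitePresentation.trans R S C
  exact this

/-- Smoothness at the centre over a formally smooth `R`-algebra `S → Ω` gives smoothness at the
centre over `R` (composite of formally smooth maps). [folklore] -/
theorem isSmoothAt_centre_restrictScalars {V : ValuationSubring Ω} [Algebra.FormallySmooth R S]
    (C : Subalgebra S Ω) (hCV : C.toSubring ≤ V.toSubring)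
    (hsm : Algebra.IsSmoothAt S (centre C V hCV)) :
    Algebra.IsSmoothAt R (centre (C.restrictScalars R) V hCV) := by
  set q := centre C V hCV with hq
  let L := Localization.AtPrime q
  haveI : Algebra.FormallySmooth S L := hsm
  haveI : IsScalarTower R S L := IsScalarTower.of_algebraMap_eq fun r => by
    rw [IsScalarTower.algebraMap_apply R C L, IsScalarTower.algebraMap_apply S C L]
    congr 1
    apply Subtype.ext
    exact IsScalarTower.algebraMap_apply R S Ω r
  have : Algebra.FormallySmooth R L := Algebra.FormallySmooth.comp R S L
  exact this

end Tower


/-! ## The engine: Prop. 3.10 over the separable closure of a subfield of codimension one -/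

/-- **The case `n = 1` of Knaf–Kuhlmann 2009, Thm. 1.1, over the separable closure** (§4.1,
p. 16: "Lemma 2.1 implies that the extension `(E^{sep}|K^{sep}, 𝓟)` and hence also its
subextension `(E.K^{sep}|K^{sep}, 𝓟)` are immediate. Since `(K^{sep}, 𝓟)` is a separably tame
field, we can apply Proposition 3.10 to see that `𝓟|_{E.K^{sep}}` is strongly smoothly
`O_{K^{sep}}`-uniformizable. We express every `z ∈ Z` in the form `z = u z'`,
`u ∈ O_{E.K^{sep}}^×` and `z' ∈ O_{K^{sep}}`"), relative to a subfield `E₀ ≤ E` over which `E`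
is separable of transcendence degree `1` (separating element `t₁`), the torsion / algebraicity
hypotheses being required over some `K ≤ E₀`: with `L := E₀^{sep}` there is an `O_L`-model `A` of
`E.L`, smooth at the centre, such that every `z ∈ Z` is `(a/b) z'` with `a, b ∈ A` units at the
centre and `z' ∈ O_L`. Conditional on the named fact `KnafKuhlmann2009_Prop310_sepClosed`.
[cite: KnafKuhlmann2009, Section 4.1 (proof of Thm. 1.1, case n = 1)] -/
theorem exists_model_over_separableClosure (h310 : KnafKuhlmann2009_Prop310_sepClosed.{u})
    [IsAlgClosed Ω] (V : ValuationSubring Ω) {K E₀ E : Subfield Ω} (hKE₀ : K ≤ E₀)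
    (hE₀E : E₀ ≤ E) (hfg : FGOver K E) {t₁ : Ω} (ht₁E : t₁ ∈ E) (ht₁ : Transcendental E₀ t₁)
    (hsep : ∀ x ∈ E, IsSeparable (IntermediateField.adjoin E₀ ({t₁} : Set Ω)) x)
    (htor : IsValueTorsionOver V K E) (hres : IsResiduallyAlgebraicOver V K E)
    (L : Subfield Ω) (hL : L = (separableClosure E₀ Ω).toSubfield)
    (Z : Finset Ω) (hZ : ∀ z ∈ Z, z ∈ V ∧ z ∈ E) :
    ∃ (A : Subalgebra ↥(V.toSubring ⊓ L.toSubring) Ω) (hAV : A.toSubring ≤ V.toSubring),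
      (A : Set Ω) ⊆ ((E ⊔ L : Subfield Ω) : Set Ω) ∧
      Algebra.FinitePresentation ↥(V.toSubring ⊓ L.toSubring) A ∧
      (∀ x ∈ E ⊔ L, ∃ a ∈ A, ∃ b ∈ A, x = a / b) ∧
      Algebra.IsSmoothAt ↥(V.toSubring ⊓ L.toSubring) (centre A V hAV) ∧
      ∀ z ∈ Z, ∃ a ∈ A, ∃ b ∈ A, ∃ z' ∈ L, z' ∈ V ∧
        V.valuation a = 1 ∧ V.valuation b = 1 ∧ z = a / b * z' := by
  classical
  subst hL
  set L : Subfield Ω := (separableClosure E₀ Ω).toSubfield with hLdef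
  have hLsc : IsSepClosed L := isSepClosed_toSubfield_separableClosure E₀
  have hE₀L : E₀ ≤ L := le_toSubfield_separableClosure E₀
  have hKL : K ≤ L := hKE₀.trans hE₀L
  have hKE : K ≤ E := hKE₀.trans hE₀E
  have hLalg : ∀ w ∈ L, IsAlgebraic E₀ w := fun w hw =>
    ((mem_toSubfield_separableClosure_iff E₀).mp hw).isIntegral.isAlgebraic
  set F : Subfield Ω := E ⊔ L with hFdef
  have hEF : E ≤ F := le_sup_left
  have hLF : L ≤ F := le_sup_right
  -- non-triviality of the place on `K`
  have ht₁K : Transcendental K t₁ := fun h => ht₁ (isAlgebraic_of_subfield_le hKE₀ h)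
  obtain ⟨a₀, ha₀K, ha₀V⟩ := exists_mem_not_mem_valuationSubring hKE htor hres ht₁E ht₁K
  have ha₀0 : a₀ ≠ 0 := by rintro rfl; exact ha₀V V.zero_mem
  set π : Ω := a₀⁻¹ with hπdef
  have hπK : π ∈ K := inv_mem ha₀K
  have hπ0 : π ≠ 0 := inv_ne_zero ha₀0
  have hvπ : V.valuation π < 1 := by
    have hπV : π ∈ V := (V.mem_or_inv_mem a₀).resolve_left ha₀V
    have h1 : V.valuation π ≤ 1 := (V.valuation_le_one_iff π).mpr hπV
    refine lt_of_le_of_ne h1 fun heq => ha₀V ?_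
    have : V.valuation a₀ = 1 := by
      rw [hπdef, map_inv₀, inv_eq_one] at heq
      exact heq
    exact (V.valuation_le_one_iff a₀).mp this.le
  -- `F | L` is a separable function field of transcendence degree `1`
  have hfgLF : FGOver L F := hfg.sup_right hKL
  have ht₁L : Transcendental L t₁ := fun h => ht₁ (isAlgebraic_trans_subfield hE₀L hLalg h)
  have ht₁F : t₁ ∈ F := hEF ht₁E
  have hsepF : ∀ x ∈ F, IsSeparable (IntermediateField.adjoin L ({t₁} : Set Ω)) x := by
    -- over the subfield `M := L(t₁)`
    set M : Subfield Ω := Subfield.closure ((L : Set Ω) ∪ {t₁}) with hMdef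
    have hEM : ∀ x ∈ (E : Set Ω), IsSeparable M x := by
      intro x hx
      have h1 : IsSeparable (Subfield.closure ((E₀ : Set Ω) ∪ {t₁})) x :=
        (isSeparable_closure_iff E₀ {t₁} x).mpr (hsep x hx)
      exact isSeparable_of_subfield_le
        (Subfield.closure_mono (Set.union_subset_union_left _ hE₀L)) h1
    intro x hx
    rw [← isSeparable_closure_iff]
    have hxM : x ∈ Subfield.closure ((M : Set Ω) ∪ (E : Set Ω)) := by
      have hFle : F ≤ Subfield.closure ((M : Set Ω) ∪ (E : Set Ω)) := by
        refine sup_le (fun y hy => Subfield.subset_closure (Or.inr hy)) fun y hy => ?_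
        exact Subfield.subset_closure (Or.inl (Subfield.subset_closure (Or.inl hy)))
      exact hFle hx
    exact isSeparable_of_mem_closure hEM hxM
  have hsgLF : SeparablyGeneratedOver L F := by
    refine ⟨{t₁}, by simpa using ht₁F, ?_, ?_⟩
    · letI : Unique (↥({t₁} : Finset Ω)) :=
        ⟨⟨⟨t₁, Finset.mem_singleton_self t₁⟩⟩, fun x => Subtype.ext (Finset.mem_singleton.mp x.2)⟩
      exact algebraicIndependent_unique_type_iff.mpr ht₁L
    · intro x hx
      rw [Finset.coe_singleton]
      exact hsepF x hx
  have htd1 : ∃ x ∈ F, Transcendental L x ∧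
      ∀ z ∈ F, IsAlgebraic (IntermediateField.adjoin L ({x} : Set Ω)) z :=
    ⟨t₁, ht₁F, ht₁L, fun z hz => (hsepF z hz).isIntegral.isAlgebraic⟩
  -- `F | L` is immediate (Lemma 2.1)
  have htor₀ : IsValueTorsionOver V E₀ E := htor.mono_left hKE₀
  have hres₀ : IsResiduallyAlgebraicOver V E₀ E := hres.mono_left hKE₀
  have hval : ∀ w ∈ F, w ≠ 0 → ∃ b ∈ L, b ≠ 0 ∧ V.valuation w = V.valuation b :=
    fun w hw hw0 => exists_mem_separableClosure_valuation_eq V E₀ hE₀E htor₀ hw hw0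
  have himm : IsImmediateOver V L F := by
    refine ⟨fun w hw hw0 => ?_, fun r hr => ?_⟩
    · obtain ⟨b, hbL, -, hb⟩ := hval w hw hw0
      exact ⟨b, hbL, hb⟩
    · obtain ⟨w, hwF, rfl⟩ := (mem_resField_iff V F r).mp hr
      obtain ⟨c, hcL, hcV, hc⟩ :=
        exists_mem_separableClosure_valuation_sub_lt V E₀ hE₀E (hKE₀ hπK) hπ0 hvπ hres₀ hwF w.2
      have : residue V w = residue V ⟨c, hcV⟩ := (residue_eq_residue_iff V w ⟨c, hcV⟩).mpr hc
      rw [this]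
      exact residue_mem_resField V ⟨c, hcV⟩ hcL
  -- the units `u` and constants `z'` with `z = u z'`
  have hfac : ∀ z ∈ Z, ∃ u z' : Ω, u ∈ F ∧ u ∈ V ∧ V.valuation u = 1 ∧ z' ∈ L ∧ z' ∈ V ∧
      z = u * z' := by
    intro z hz
    by_cases hz0 : z = 0
    · exact ⟨1, 0, F.one_mem, V.one_mem, map_one _, L.zero_mem, V.zero_mem, by rw [hz0, mul_zero]⟩
    obtain ⟨b, hbL, hb0, hb⟩ := hval z (hEF (hZ z hz).2) hz0
    have hvb0 : V.valuation b ≠ 0 := (map_ne_zero V.valuation).mpr hb0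
    have hvu : V.valuation (z / b) = 1 := by rw [map_div₀, hb, div_self hvb0]
    refine ⟨z / b, b, div_mem (hEF (hZ z hz).2) (hLF hbL), (V.valuation_le_one_iff _).mp hvu.le,
      hvu, hbL, ?_, (div_mul_cancel₀ z hb0).symm⟩
    exact (V.valuation_le_one_iff b).mp (hb ▸ (V.valuation_le_one_iff z).mpr (hZ z hz).1)
  choose u z' huF huV hvu hz'L hz'V hzu using hfac
  let Z₁ : Finset Ω := Z.attach.image fun z => u z.1 z.2
  have hZ₁ : ∀ w ∈ Z₁, w ∈ V ∧ w ∈ F := by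
    intro w hw
    obtain ⟨z, -, rfl⟩ := Finset.mem_image.mp hw
    exact ⟨huV z.1 z.2, huF z.1 z.2⟩
  -- Prop. 3.10
  obtain ⟨A, hAV, hAF, hfp, hfrac, hsm, hZ₁A⟩ :=
    h310 Ω V L F hLsc hLF hfgLF hsgLF htd1 himm Z₁ hZ₁
  refine ⟨A, hAV, hAF, hfp, hfrac, hsm, fun z hz => ?_⟩
  have hu : u z hz ∈ Z₁ := Finset.mem_image.mpr ⟨⟨z, hz⟩, Finset.mem_attach _ _, rfl⟩
  obtain ⟨a, ha, b, hb, hvb, hab⟩ := hZ₁A _ hu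
  refine ⟨a, ha, b, hb, z' z hz, hz'L z hz, hz'V z hz, ?_, hvb, ?_⟩
  · have h := hvu z hz
    rw [hab, map_div₀, hvb, div_one] at h
    exact h
  · rw [← hab]
    exact hzu z hz


/-! ## Thm. 1.1 over a separably closed ground field: the induction of §4.1 -/

/-- **Knaf–Kuhlmann 2009, Thm. 1.1 over a separably closed ground field** (the induction on the
transcendence degree of §4.1, run over `K` separably closed so that no extension of the ground
field occurs and the ascent Prop. 3.3 is not needed): for `K ≤ E ≤ Ω` with `K` separably
closed, `E|K` finitely generated with a separating transcendence basis `t` of `n` elements,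
`vE/vK` torsion, `EP|KP` algebraic and `Z ⊆ V ∩ E` finite, there are a finite separable
extension `𝓔|E` inside `Ω` and an `O_K`-model `A ⊆ V ∩ 𝓔` of `𝓔`, finitely presented and smooth
over `O_K` at the centre, on which every `z ∈ Z` factors as `z = (a/b) z'` with `a, b ∈ A` units
of `V` and `z' ∈ O_K`. Step `n → n + 1` (§4.1, pp. 16–17): split `t = T₀ ∪ {t₁}`,
`E₀ := K(T₀)`, `L := E₀^{sep}`; the engine `exists_model_over_separableClosure` gives an
`O_L`-model `A` of `E.L` with the factorizations `z = u z'`; Prop. 3.2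
(`knafKuhlmann2009_prop32_adjoin`) gives descent data `S₀ ⊆ O_L`, `G ⊆ A_q`; the induction
hypothesis for `ℰ₀ := K(T₀, S₀, Z') ⊆ L` yields `ℰ₁ ⊇ ℰ₀` finite separable (so `ℰ₁ ⊆ L`) and an
`O_K`-model `B` of `ℰ₁` with `S₀ ∪ Z'` in its local ring, improved to an everywhere smooth
`B₂ ⊇ S₀ ∪ Z'`; descent to `S' := B₂` gives `C := B₂[G] ⊆ A_q`, and `𝓔 := Frac C`.
Conditional on `KnafKuhlmann2009_Prop310_sepClosed`.
[cite: KnafKuhlmann2009, Thm. 1.1 and Section 4.1] -/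
theorem knafKuhlmann2009_thm11_sepClosed (h310 : KnafKuhlmann2009_Prop310_sepClosed.{u})
    [IsAlgClosed Ω] (V : ValuationSubring Ω) (K : Subfield Ω) (hKsc : IsSepClosed K) (n : ℕ) :
    ∀ (E : Subfield Ω) (t : Finset Ω) (Z : Finset Ω), t.card = n → K ≤ E → FGOver K E →
      (t : Set Ω) ⊆ E → AlgebraicIndependent K ((↑) : t → Ω) →
      (∀ x ∈ E, IsSeparable (IntermediateField.adjoin K (t : Set Ω)) x) →
      IsValueTorsionOver V K E → IsResiduallyAlgebraicOver V K E →
      (∀ z ∈ Z, z ∈ V ∧ z ∈ E) →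
      ∃ 𝓔 : Subfield Ω, E ≤ 𝓔 ∧ FiniteSeparableOver E 𝓔 ∧
        ∃ (A : Subalgebra ↥(V.toSubring ⊓ K.toSubring) Ω) (hAV : A.toSubring ≤ V.toSubring),
          (A : Set Ω) ⊆ 𝓔 ∧ Algebra.FinitePresentation ↥(V.toSubring ⊓ K.toSubring) A ∧
          (∀ x ∈ 𝓔, ∃ a ∈ A, ∃ b ∈ A, x = a / b) ∧
          Algebra.IsSmoothAt ↥(V.toSubring ⊓ K.toSubring) (centre A V hAV) ∧
          ∀ z ∈ Z, ∃ a ∈ A, ∃ b ∈ A, ∃ z' ∈ K, z' ∈ V ∧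
            V.valuation a = 1 ∧ V.valuation b = 1 ∧ z = a / b * z' := by
  classical
  haveI := hKsc
  set O : Subring Ω := V.toSubring ⊓ K.toSubring with hOdef
  induction n with
  | zero =>
    intro E t Z hcard hKE _ _ _ hsep _ _ hZ
    have ht : t = ∅ := Finset.card_eq_zero.mp hcard
    subst ht
    -- every element of `E` is separable over `K`, hence lies in `K`
    have hEK : E ≤ K := by
      intro x hx
      refine mem_of_isSeparable_of_isSepClosed K ?_
      have h1 : IsSeparable (Subfield.closure ((K : Set Ω) ∪ ((∅ : Finset Ω) : Set Ω))) x :=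
        (isSeparable_closure_iff K _ x).mpr (hsep x hx)
      exact isSeparable_of_subfield_le (Subfield.closure_le.mpr (by simp)) h1
    obtain rfl : E = K := le_antisymm hEK hKE
    obtain ⟨A, hAV, hAK, hfp, hfrac, hsm, hfac⟩ := exists_model_bot V E Z hZ
    refine ⟨E, le_rfl, ⟨∅, by simp, by simp⟩, A, hAV, hAK, hfp, hfrac, hsm, hfac⟩
  | succ n ih =>
    intro E t Z hcard hKE hfg htE hind hsep htor hres hZ
    -- split off one element of the separating transcendence basis
    obtain ⟨t₁, ht₁t⟩ : t.Nonempty := Finset.card_pos.mp (by omega)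
    set T₀ : Finset Ω := t.erase t₁ with hT₀def
    have hT₀card : T₀.card = n := by rw [hT₀def, Finset.card_erase_of_mem ht₁t, hcard]; rfl
    have hT₀t : T₀ ⊆ t := Finset.erase_subset _ _
    have ht₁E : t₁ ∈ E := htE ht₁t
    set E₀ : Subfield Ω := Subfield.closure ((K : Set Ω) ∪ (T₀ : Set Ω)) with hE₀def
    have hKE₀ : K ≤ E₀ := fun c hc => Subfield.subset_closure (Or.inl hc)
    have hT₀E₀ : (T₀ : Set Ω) ⊆ E₀ := fun c hc => Subfield.subset_closure (Or.inr hc)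
    have hE₀E : E₀ ≤ E :=
      Subfield.closure_le.mpr (Set.union_subset hKE fun c hc => htE (hT₀t hc))
    -- `t₁` is transcendental over `E₀ = K(T₀)`
    have ht₁ : Transcendental E₀ t₁ := by
      have h1 := hind.transcendental_adjoin (s := {i : ↥t | (i : Ω) ≠ t₁}) (i := ⟨t₁, ht₁t⟩)
        (by simp)
      have himg : ((↑) : ↥t → Ω) '' {i : ↥t | (i : Ω) ≠ t₁} = (T₀ : Set Ω) := by
        ext x
        simp only [Set.mem_image, Set.mem_setOf_eq, hT₀def, Finset.coe_erase, Set.mem_sdiff,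
          Finset.mem_coe, Set.mem_singleton_iff]
        constructor
        · rintro ⟨⟨y, hy⟩, hne, rfl⟩; exact ⟨hy, hne⟩
        · rintro ⟨hx, hne⟩; exact ⟨⟨x, hx⟩, hne, rfl⟩
      rw [himg] at h1
      have h2 : Transcendental (IntermediateField.adjoin K (T₀ : Set Ω)) t₁ :=
        IntermediateField.transcendental_adjoin_iff.mpr h1
      exact fun h => h2 ((isAlgebraic_closure_iff K _ t₁).mp h)
    -- `E | E₀` is separable with separating element `t₁`
    have hsep₀ : ∀ x ∈ E, IsSeparable (IntermediateField.adjoin E₀ ({t₁} : Set Ω)) x := by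
      intro x hx
      rw [← isSeparable_closure_iff]
      have h1 : IsSeparable (Subfield.closure ((K : Set Ω) ∪ (t : Set Ω))) x :=
        (isSeparable_closure_iff K _ x).mpr (hsep x hx)
      refine isSeparable_of_subfield_le (Subfield.closure_le.mpr (Set.union_subset ?_ ?_)) h1
      · exact fun c hc => Subfield.subset_closure (Or.inl (hKE₀ hc))
      · intro c hc
        by_cases hct : c = t₁
        · exact Subfield.subset_closure (Or.inr hct)
        · exact Subfield.subset_closure (Or.inl (hT₀E₀ (Finset.mem_coe.mpr
            (Finset.mem_erase.mpr ⟨hct, hc⟩))))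
    -- generators of `E` inside `V`
    obtain ⟨gE, hgEVE, hgE⟩ := hfg.exists_finset_subset V
    let Zg : Finset Ω := Z ∪ gE
    have hZg : ∀ z ∈ Zg, z ∈ V ∧ z ∈ E := fun z hz =>
      (Finset.mem_union.mp hz).elim (hZ z) (hgEVE z)
    -- the engine over `L := E₀^{sep}`
    set L : Subfield Ω := (separableClosure E₀ Ω).toSubfield with hLdef
    set F : Subfield Ω := E ⊔ L with hFdef
    have hE₀L : E₀ ≤ L := le_toSubfield_separableClosure E₀
    have hKL : K ≤ L := hKE₀.trans hE₀L
    have hLsep : L ≤ (separableClosure E Ω).toSubfield := toSubfield_separableClosure_mono hE₀E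
    obtain ⟨A, hAV, hAF, hfpA, hfracA, hsmA, hfacA⟩ := exists_model_over_separableClosure h310 V
      hKE₀ hE₀E hfg ht₁E ht₁ hsep₀ htor hres L hLdef Zg hZg
    haveI := hfpA
    choose a ha b hb z' hz'L hz'V hva hvb hzab using hfacA
    let U : Finset Ω := Zg.attach.image fun z => a z.1 z.2 / b z.1 z.2
    let Z' : Finset Ω := Zg.attach.image fun z => z' z.1 z.2
    have hU : ∀ w ∈ U, ∃ a ∈ A, ∃ b ∈ A, V.valuation b = 1 ∧ w = a / b := by
      intro w hw
      obtain ⟨z, -, rfl⟩ := Finset.mem_image.mp hw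
      exact ⟨a z.1 z.2, ha z.1 z.2, b z.1 z.2, hb z.1 z.2, hvb z.1 z.2, rfl⟩
    have hZ'LV : ∀ w ∈ Z', w ∈ L ∧ w ∈ V := by
      intro w hw
      obtain ⟨z, -, rfl⟩ := Finset.mem_image.mp hw
      exact ⟨hz'L z.1 z.2, hz'V z.1 z.2⟩
    -- Prop. 3.2: descent data
    let S : Type u := ↥(V.toSubring ⊓ L.toSubring)
    have hSinj : Function.Injective (algebraMap S Ω) := Subtype.coe_injective
    have hrangeS : Set.range (algebraMap S Ω) =
        ((V.toSubring ⊓ L.toSubring : Subring Ω) : Set Ω) := Subtype.range_coe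
    obtain ⟨S₀, G, hS₀S, hGA, hdesc⟩ := knafKuhlmann2009_prop32_adjoin V S hSinj A hAV hsmA U hU
    have hS₀LV : ∀ w ∈ S₀, w ∈ L ∧ w ∈ V := by
      intro w hw
      have hw' : w ∈ Set.range (algebraMap S Ω) := hS₀S (Finset.mem_coe.mpr hw)
      rw [hrangeS] at hw'
      exact ⟨hw'.2, hw'.1⟩
    -- the induction hypothesis for `ℰ₀ := K(T₀, S₀, Z')`
    set ℰ₀ : Subfield Ω := Subfield.closure ((K : Set Ω) ∪ ((T₀ ∪ (S₀ ∪ Z') : Finset Ω) : Set Ω))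
      with hℰ₀def
    have hKℰ₀ : K ≤ ℰ₀ := fun c hc => Subfield.subset_closure (Or.inl hc)
    have hT₀ℰ₀ : (T₀ : Set Ω) ⊆ ℰ₀ := fun c hc =>
      Subfield.subset_closure (Or.inr (by simp [Finset.mem_coe.mp hc]))
    have hSZℰ₀ : ((S₀ ∪ Z' : Finset Ω) : Set Ω) ⊆ ℰ₀ := fun c hc =>
      Subfield.subset_closure (Or.inr (by
        rcases Finset.mem_union.mp (Finset.mem_coe.mp hc) with h | h <;> simp [h]))
    have hE₀ℰ₀ : E₀ ≤ ℰ₀ := Subfield.closure_le.mpr (Set.union_subset hKℰ₀ hT₀ℰ₀)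
    have hℰ₀L : ℰ₀ ≤ L := by
      refine Subfield.closure_le.mpr (Set.union_subset hKL fun c hc => ?_)
      rcases Finset.mem_union.mp (Finset.mem_coe.mp hc) with h | h
      · exact hE₀L (hT₀E₀ (Finset.mem_coe.mpr h))
      · rcases Finset.mem_union.mp h with h | h
        · exact (hS₀LV c h).1
        · exact (hZ'LV c h).1
    have hindT₀ : AlgebraicIndependent K ((↑) : ↥T₀ → Ω) := by
      have h := hind.comp (fun x : ↥T₀ => (⟨x.1, hT₀t x.2⟩ : ↥t)) (by
        intro x y hxy
        apply Subtype.ext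
        have h := congrArg Subtype.val hxy
        exact h)
      exact h
    have hsepℰ₀ : ∀ x ∈ ℰ₀, IsSeparable (IntermediateField.adjoin K (T₀ : Set Ω)) x := by
      intro x hx
      rw [← isSeparable_closure_iff]
      have hgen : ∀ y ∈ (((S₀ ∪ Z' : Finset Ω)) : Set Ω), IsSeparable E₀ y := by
        intro y hy
        have hyL : y ∈ L := by
          rcases Finset.mem_union.mp (Finset.mem_coe.mp hy) with h | h
          · exact (hS₀LV y h).1
          · exact (hZ'LV y h).1
        exact (mem_toSubfield_separableClosure_iff E₀).mp hyL
      refine isSeparable_of_mem_closure hgen ?_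
      have hle : ℰ₀ ≤ Subfield.closure ((E₀ : Set Ω) ∪ ((S₀ ∪ Z' : Finset Ω) : Set Ω)) := by
        refine Subfield.closure_le.mpr (Set.union_subset ?_ fun c hc => ?_)
        · exact fun c hc => Subfield.subset_closure (Or.inl (hKE₀ hc))
        · rcases Finset.mem_union.mp (Finset.mem_coe.mp hc) with h | h
          · exact Subfield.subset_closure (Or.inl (hT₀E₀ (Finset.mem_coe.mpr h)))
          · exact Subfield.subset_closure (Or.inr (Finset.mem_coe.mpr h))
      exact hle hx
    have htorℰ₀ : IsValueTorsionOver V K ℰ₀ :=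
      (isValueTorsionOver_separableClosure htor).mono_right (hℰ₀L.trans hLsep)
    have hresℰ₀ : IsResiduallyAlgebraicOver V K ℰ₀ :=
      (isResiduallyAlgebraicOver_separableClosure hKE hres).mono_right (hℰ₀L.trans hLsep)
    have hSZ : ∀ w ∈ S₀ ∪ Z', w ∈ V ∧ w ∈ ℰ₀ := fun w hw =>
      ⟨(Finset.mem_union.mp hw).elim (fun h => (hS₀LV w h).2) (fun h => (hZ'LV w h).2),
        hSZℰ₀ (Finset.mem_coe.mpr hw)⟩
    obtain ⟨ℰ₁, hℰ₀ℰ₁, hfinsep₁, B, hBV, hBℰ₁, hfpB, hfracB, hsmB, hfacB⟩ :=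
      ih ℰ₀ T₀ (S₀ ∪ Z') hT₀card hKℰ₀ (fgOver_closure K _) hT₀ℰ₀ hindT₀ hsepℰ₀ htorℰ₀ hresℰ₀ hSZ
    haveI := hfpB
    have hℰ₁L : ℰ₁ ≤ L := le_separableClosure_of_finiteSeparableOver hℰ₀L hfinsep₁
    -- an everywhere smooth `O_K`-model `B₂ ⊇ S₀ ∪ Z'` of `ℰ₁`
    have hSZB : ∀ w ∈ S₀ ∪ Z', ∃ a ∈ B, ∃ b ∈ B, V.valuation b = 1 ∧ w = a / b := by
      intro w hw
      obtain ⟨a', ha', b', hb', w', hw'K, hw'V, -, hvb', hw⟩ := hfacB w hw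
      refine ⟨a' * w', mul_mem ha' (B.algebraMap_mem (⟨w', hw'V, hw'K⟩ : O)), b', hb', hvb', ?_⟩
      rw [hw, div_mul_eq_mul_div]
    obtain ⟨B₂, hB₂V, hB₂ℰ₁, hB₂sm, hSZB₂, hBB₂, hfracB₂, -⟩ :=
      exists_smooth_model_over B hBV hBℰ₁ hsmB hfracB (S₀ ∪ Z') hSZB
    haveI := hB₂sm
    haveI : Algebra.FormallySmooth O B₂ := hB₂sm.1
    haveI : Algebra.FinitePresentation O B₂ := hB₂sm.2
    -- Prop. 3.2: descent to `S' := B₂`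
    have hB₂inj : Function.Injective (algebraMap B₂ Ω) := Subtype.coe_injective
    have hrangeB₂ : Set.range (algebraMap B₂ Ω) = (B₂ : Set Ω) := Subtype.range_coe
    have h2 : (S₀ : Set Ω) ⊆ Set.range (algebraMap B₂ Ω) := by
      rw [hrangeB₂]
      exact fun w hw => hSZB₂ (by simp [Finset.mem_coe.mp hw])
    have h3 : Set.range (algebraMap B₂ Ω) ⊆ Set.range (algebraMap S Ω) := by
      rw [hrangeB₂, hrangeS]
      exact fun w hw => ⟨hB₂V hw, hℰ₁L (hB₂ℰ₁ hw)⟩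
    obtain ⟨C, hCV, hCeq, hCA, hfpC, hsmC, hUC, -⟩ := hdesc B₂ hB₂inj h2 h3
    haveI := hfpC
    -- the model `C` over `O_K` and its fraction field `𝓔`
    have hB₂C : (B₂ : Set Ω) ⊆ C := fun w hw => C.algebraMap_mem (⟨w, hw⟩ : B₂)
    have hCF : (C : Set Ω) ⊆ F := by
      intro w hw
      obtain ⟨a', ha', b', hb', -, rfl⟩ := hCA w hw
      exact div_mem (hAF ha') (hAF hb')
    set 𝓔 : Subfield Ω := Subfield.closure (C : Set Ω) with h𝓔def
    have hC𝓔 : (C : Set Ω) ⊆ 𝓔 := Subfield.subset_closure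
    have hK𝓔 : K ≤ 𝓔 := by
      refine subfield_le_closure_of_inf_subset V K fun w hw => hB₂C ?_
      exact B₂.algebraMap_mem (⟨w, hw⟩ : O)
    have hU𝓔 : ∀ z (hz : z ∈ Zg), a z hz / b z hz ∈ 𝓔 ∧ z' z hz ∈ C := by
      intro z hz
      have hu : a z hz / b z hz ∈ U :=
        Finset.mem_image.mpr ⟨⟨z, hz⟩, Finset.mem_attach _ _, rfl⟩
      obtain ⟨a', ha', b', hb', -, h⟩ := hUC _ hu
      refine ⟨h ▸ div_mem (hC𝓔 ha') (hC𝓔 hb'), hB₂C (hSZB₂ ?_)⟩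
      have : z' z hz ∈ Z' := Finset.mem_image.mpr ⟨⟨z, hz⟩, Finset.mem_attach _ _, rfl⟩
      simp [this]
    have hE𝓔 : E ≤ 𝓔 := by
      rw [← hgE]
      refine Subfield.closure_le.mpr (Set.union_subset hK𝓔 fun g hg => ?_)
      have hgZ : g ∈ Zg := Finset.mem_union_right _ hg
      rw [hzab g hgZ]
      exact mul_mem (hU𝓔 g hgZ).1 (hC𝓔 (hU𝓔 g hgZ).2)
    -- `𝓔 | E` is finite separable, generated by `G` and generators of `B₂`
    obtain ⟨G_B, hG_B⟩ : B₂.FG := (Subalgebra.fg_iff_finiteType B₂).mpr inferInstance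
    have hG_BB₂ : (G_B : Set Ω) ⊆ B₂ := hG_B ▸ Algebra.subset_adjoin
    have hGC : (G : Set Ω) ⊆ C := by rw [hCeq]; exact Algebra.subset_adjoin
    have hfinsep : FiniteSeparableOver E 𝓔 := by
      refine ⟨G ∪ G_B, fun x hx => ?_, ?_⟩
      · have hxF : x ∈ F := by
          rcases Finset.mem_union.mp hx with h | h
          · exact hCF (hGC (Finset.mem_coe.mpr h))
          · exact (show L ≤ F from le_sup_right) (hℰ₁L (hB₂ℰ₁ (hG_BB₂ (Finset.mem_coe.mpr h))))
        exact isSeparable_of_mem_sup_separableClosure hE₀E hxF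
      · apply le_antisymm
        · refine Subfield.closure_le.mpr (Set.union_subset hE𝓔 fun x hx => ?_)
          rcases Finset.mem_union.mp hx with h | h
          · exact hC𝓔 (hGC (Finset.mem_coe.mpr h))
          · exact hC𝓔 (hB₂C (hG_BB₂ (Finset.mem_coe.mpr h)))
        · refine Subfield.closure_le.mpr ?_
          set W : Subfield Ω := Subfield.closure ((E : Set Ω) ∪ ((G ∪ G_B : Finset Ω) : Set Ω))
          have hKW : ∀ c : ↥O, (c : Ω) ∈ W := fun c =>
            Subfield.subset_closure (Or.inl (hKE c.2.2))
          let WO : Subalgebra O Ω := { W.toSubring with algebraMap_mem' := hKW }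
          have hB₂W : B₂ ≤ WO := by
            rw [← hG_B]
            refine Algebra.adjoin_le fun g hg => ?_
            change g ∈ W
            exact Subfield.subset_closure (Or.inr (by simp [Finset.mem_coe.mp hg]))
          let WB : Subalgebra B₂ Ω := { W.toSubring with algebraMap_mem' := fun c => hB₂W c.2 }
          have hCW : C ≤ WB := by
            rw [hCeq]
            refine Algebra.adjoin_le fun g hg => ?_
            change g ∈ W
            exact Subfield.subset_closure (Or.inr (by simp [Finset.mem_coe.mp hg]))
          exact fun w hw => hCW hw
    refine ⟨𝓔, hE𝓔, hfinsep, C.restrictScalars O, hCV, hC𝓔,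
      finitePresentation_restrictScalars (R := O) B₂ C,
      fun x hx => exists_div_of_mem_closure C.toSubring hx,
      isSmoothAt_centre_restrictScalars (R := O) B₂ C hCV hsmC, fun z hz => ?_⟩
    -- the factorizations `z = u u' z''`
    have hzZ : z ∈ Zg := Finset.mem_union_left _ hz
    have hu : a z hzZ / b z hzZ ∈ U :=
      Finset.mem_image.mpr ⟨⟨z, hzZ⟩, Finset.mem_attach _ _, rfl⟩
    obtain ⟨a₁, ha₁, b₁, hb₁, hvb₁, hu₁⟩ := hUC _ hu
    have hva₁ : V.valuation a₁ = 1 := by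
      have h := congrArg V.valuation hu₁
      rw [map_div₀, map_div₀, hva z hzZ, hvb z hzZ, hvb₁, div_one, div_one] at h
      exact h.symm
    have hz'mem : z' z hzZ ∈ S₀ ∪ Z' :=
      Finset.mem_union_right _ (Finset.mem_image.mpr ⟨⟨z, hzZ⟩, Finset.mem_attach _ _, rfl⟩)
    obtain ⟨a₂, ha₂, b₂, hb₂, z'', hz''K, hz''V, hva₂, hvb₂, hfac₂⟩ := hfacB _ hz'mem
    refine ⟨a₁ * a₂, mul_mem ha₁ (hB₂C (hBB₂ ha₂)), b₁ * b₂, mul_mem hb₁ (hB₂C (hBB₂ hb₂)),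
      z'', hz''K, hz''V, by rw [map_mul, hva₁, hva₂, one_mul], by rw [map_mul, hvb₁, hvb₂, one_mul],
      ?_⟩
    rw [hzab z hzZ, hu₁, hfac₂, ← mul_assoc, div_mul_div_comm]


/-! ## Thm. 1.1 -/

/-- Algebraic independence over a subfield `K` persists over an algebraic extension `K' ⊇ K`
inside `Ω`. [folklore] -/
theorem algebraicIndependent_of_isAlgebraic_subfield {K K' : Subfield Ω} (hKK' : K ≤ K')
    (halg : ∀ x ∈ K', IsAlgebraic K x) {ι : Type*} {x : ι → Ω}
    (hx : AlgebraicIndependent K x) : AlgebraicIndependent K' x := by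
  letI : Algebra K K' := (Subfield.inclusion hKK').toAlgebra
  haveI : IsScalarTower K K' Ω := IsScalarTower.of_algebraMap_eq fun _ => rfl
  haveI : Algebra.IsAlgebraic K K' := ⟨fun y =>
    (isAlgebraic_algebraMap_iff (R := K) (A := Ω) (algebraMap K' Ω).injective).mp (halg y y.2)⟩
  exact hx.extendScalars K'

/-- Elements of a finite separable extension of `E ⊔ K^{sep}` (`K ≤ E`) are separable over `E`.
[folklore] -/
theorem isSeparable_of_finiteSeparableOver_sup_separableClosure {K E 𝓔 : Subfield Ω} (hKE : K ≤ E)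
    (h : FiniteSeparableOver (E ⊔ (separableClosure K Ω).toSubfield) 𝓔) {x : Ω} (hx : x ∈ 𝓔) :
    IsSeparable E x := by
  set K' : Subfield Ω := (separableClosure K Ω).toSubfield with hK'def
  have h1 : IsSeparable (↥(E ⊔ K')) x := h.isSeparable hx
  have hcl : Subfield.closure ((E : Set Ω) ∪ (K' : Set Ω)) = E ⊔ K' := by
    rw [closure_union_eq_sup, Subfield.closure_eq]
  have h2 : IsSeparable (Subfield.closure ((E : Set Ω) ∪ (K' : Set Ω))) x :=
    isSeparable_of_subfield_le hcl.symm.le h1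
  rw [isSeparable_closure_iff] at h2
  haveI : Algebra.IsSeparable E (IntermediateField.adjoin E (K' : Set Ω)) :=
    (IntermediateField.isSeparable_adjoin_iff_isSeparable E Ω).mpr fun y hy =>
      isSeparable_of_subfield_le hKE ((mem_toSubfield_separableClosure_iff K).mp hy)
  exact IsSeparable.of_algebra_isSeparable_of_isSeparable E h2

/-- **Knaf–Kuhlmann 2009, Thm. 1.1** (existence part, as vendored in
`FiniteExtensionUniformization.lean`) **from Prop. 3.10 over separably closed ground fields** —
PROVED modulo the named fact `KnafKuhlmann2009_Prop310_sepClosed`: pass to `K' := K^{sep}` and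
`E' := E.K'` (still a separable function field with `vE'/vK'` torsion — indeed trivial — and
`E'P|K'P` algebraic, by Lemma 2.1 = `SeparableClosureValuation.lean`), apply
`knafKuhlmann2009_thm11_sepClosed`, and descend the `O_{K'}`-model to `O_𝒦` for a finite
`𝒦|K(Z') ` inside `K'` by Prop. 3.4 (2) (`KnafKuhlmann2009_Prop34_2_holds`), `Z' ⊆ O_{K'}` being
the finitely many constants of the factorizations `z = u z'`. (The paper's §4.1 runs the
induction over `K` itself, using Prop. 3.3 to ascend along the ground field extensions; over
`K^{sep}` no such extension occurs.) [cite: KnafKuhlmann2009, Thm. 1.1] -/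
theorem KnafKuhlmann2009_Thm11.of_prop310 (h310 : KnafKuhlmann2009_Prop310_sepClosed.{u}) :
    KnafKuhlmann2009_Thm11.{u} := by
  intro Ω _ _ V K E hKE hfg hsg htor hres Z hZ
  classical
  -- Step 0: the separably closed ground field `K' := K^{sep}` and `E' := E.K'`
  set K' : Subfield Ω := (separableClosure K Ω).toSubfield with hK'def
  have hK'sc : IsSepClosed K' := isSepClosed_toSubfield_separableClosure K
  have hKK' : K ≤ K' := le_toSubfield_separableClosure K
  have hK'alg : ∀ x ∈ K', IsAlgebraic K x := fun x hx =>
    ((mem_toSubfield_separableClosure_iff K).mp hx).isIntegral.isAlgebraic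
  set E' : Subfield Ω := E ⊔ K' with hE'def
  have hK'E' : K' ≤ E' := le_sup_right
  have hEE' : E ≤ E' := le_sup_left
  have hclE' : Subfield.closure ((E : Set Ω) ∪ (K' : Set Ω)) = E' := by
    rw [closure_union_eq_sup, Subfield.closure_eq]
  have hfg' : FGOver K' E' := hfg.sup_right hKK'
  obtain ⟨t, htE, hind, hsep⟩ := hsg
  have hind' : AlgebraicIndependent K' ((↑) : t → Ω) :=
    algebraicIndependent_of_isAlgebraic_subfield hKK' hK'alg hind
  have htE' : (t : Set Ω) ⊆ E' := fun x hx => hEE' (htE hx)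
  have hsep' : ∀ x ∈ E', IsSeparable (IntermediateField.adjoin K' (t : Set Ω)) x := by
    set M : Subfield Ω := Subfield.closure ((K' : Set Ω) ∪ (t : Set Ω)) with hMdef
    have hEM : ∀ x ∈ (E : Set Ω), IsSeparable M x := fun x hx =>
      isSeparable_of_subfield_le (Subfield.closure_mono (Set.union_subset_union_left _ hKK'))
        ((isSeparable_closure_iff K _ x).mpr (hsep x hx))
    intro x hx
    rw [← isSeparable_closure_iff]
    refine isSeparable_of_mem_closure hEM ?_
    have hle : E' ≤ Subfield.closure ((M : Set Ω) ∪ (E : Set Ω)) :=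
      sup_le (fun y hy => Subfield.subset_closure (Or.inr hy)) fun y hy =>
        Subfield.subset_closure (Or.inl (Subfield.subset_closure (Or.inl hy)))
    exact hle hx
  have htor' : IsValueTorsionOver V K' E' := by
    intro w hw hw0
    obtain ⟨b, hbK', -, hb⟩ := exists_mem_separableClosure_valuation_eq V K hKE htor hw hw0
    exact ⟨1, one_ne_zero, b, hbK', by rw [pow_one, hb]⟩
  have hres' : IsResiduallyAlgebraicOver V K' E' := by
    intro r hr
    obtain ⟨w, hwE', rfl⟩ := (mem_resField_iff V E' r).mp hr
    obtain ⟨P, hP0, hPE, hPw⟩ := exists_eval_eq_zero_of_mem_sup_separableClosure K hKE hwE'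
    have h1 := isAlgebraic_residue_of_eval_eq_zero V E hP0 hPE w.2 hPw
    exact isAlgebraic_of_subfield_le (resField_mono V hKK')
      (isAlgebraic_trans_subfield (resField_mono V hKE) hres h1)
  -- generators of `E` inside `V`, added to `Z`
  obtain ⟨gE, hgEVE, hgE⟩ := hfg.exists_finset_subset V
  let Zg : Finset Ω := Z ∪ gE
  have hZg : ∀ z ∈ Zg, z ∈ V ∧ z ∈ E' := fun z hz =>
    (Finset.mem_union.mp hz).elim (fun h => ⟨(hZ z h).1, hEE' (hZ z h).2⟩)
      fun h => ⟨(hgEVE z h).1, hEE' (hgEVE z h).2⟩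
  -- Step 1: Thm. 1.1 over `K'`
  obtain ⟨𝓔', hE'𝓔', hfinsep', A, hAV, hA𝓔', hfpA, hfracA, hsmA, hfacA⟩ :=
    knafKuhlmann2009_thm11_sepClosed h310 V K' hK'sc t.card E' t Zg rfl hK'E' hfg' htE' hind'
      hsep' htor' hres' hZg
  haveI := hfpA
  choose a ha b hb z' hz'K' hz'V hva hvb hzab using hfacA
  let U : Finset Ω := Zg.attach.image fun z => a z.1 z.2 / b z.1 z.2
  let Z' : Finset Ω := Zg.attach.image fun z => z' z.1 z.2
  obtain ⟨G₀, hG₀⟩ : A.FG := (Subalgebra.fg_iff_finiteType A).mpr inferInstance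
  have hG₀A : (G₀ : Set Ω) ⊆ A := hG₀ ▸ Algebra.subset_adjoin
  -- Step 2: finite descent of the constants (Prop. 3.4 (2)) over `k₁ := K(Z')`
  set k₁ : Subfield Ω := Subfield.closure ((K : Set Ω) ∪ (Z' : Set Ω)) with hk₁def
  have hZ'K' : (Z' : Set Ω) ⊆ K' := by
    intro w hw
    obtain ⟨z, -, rfl⟩ := Finset.mem_image.mp (Finset.mem_coe.mp hw)
    exact hz'K' z.1 z.2
  have hKk₁ : K ≤ k₁ := fun c hc => Subfield.subset_closure (Or.inl hc)
  have hZ'k₁ : (Z' : Set Ω) ⊆ k₁ := fun c hc => Subfield.subset_closure (Or.inr hc)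
  have hk₁K' : k₁ ≤ K' := Subfield.closure_le.mpr (Set.union_subset hKK' hZ'K')
  have hK'alg₁ : ∀ x ∈ K', IsAlgebraic k₁ x := fun x hx => isAlgebraic_of_subfield_le hKk₁ (hK'alg x hx)
  let Zbig : Finset Ω := Zg ∪ U ∪ G₀
  set F₁ : Subfield Ω := Subfield.closure ((k₁ : Set Ω) ∪ (Zbig : Set Ω)) with hF₁def
  have hk₁F₁ : k₁ ≤ F₁ := fun c hc => Subfield.subset_closure (Or.inl hc)
  have hZbigF₁ : (Zbig : Set Ω) ⊆ F₁ := fun c hc => Subfield.subset_closure (Or.inr hc)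
  have hZbigA : ∀ w ∈ Zbig, ∃ a ∈ A, ∃ b ∈ A, V.valuation b = 1 ∧ w = a / b := by
    intro w hw
    rcases Finset.mem_union.mp hw with hw | hw
    · rcases Finset.mem_union.mp hw with hw | hw
      · refine ⟨a w hw * z' w hw, mul_mem (ha w hw) (A.algebraMap_mem
          (⟨z' w hw, hz'V w hw, hz'K' w hw⟩ : ↥(V.toSubring ⊓ K'.toSubring))), b w hw, hb w hw,
          hvb w hw, ?_⟩
        calc w = a w hw / b w hw * z' w hw := hzab w hw
          _ = a w hw * z' w hw / b w hw := by rw [div_mul_eq_mul_div]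
      · obtain ⟨z, -, rfl⟩ := Finset.mem_image.mp hw
        exact ⟨a z.1 z.2, ha z.1 z.2, b z.1 z.2, hb z.1 z.2, hvb z.1 z.2, rfl⟩
    · exact ⟨w, hG₀A hw, 1, one_mem A, map_one _, by rw [div_one]⟩
  have hZbigV : ∀ w ∈ Zbig, w ∈ V ∧ w ∈ F₁ := by
    intro w hw
    refine ⟨?_, hZbigF₁ (Finset.mem_coe.mpr hw)⟩
    obtain ⟨a', ha', b', hb', hvb', rfl⟩ := hZbigA w hw
    have : V.valuation (a' / b') ≤ 1 := by
      rw [map_div₀, hvb', div_one]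
      exact (V.valuation_le_one_iff _).mpr (hAV ha')
    exact (V.valuation_le_one_iff _).mp this
  -- `F₁.K' = 𝓔'`
  have hA𝓔'cl : Subfield.closure ((K' : Set Ω) ∪ (G₀ : Set Ω)) = 𝓔' := by
    apply le_antisymm
    · exact Subfield.closure_le.mpr (Set.union_subset (hK'E'.trans hE'𝓔') fun g hg => hA𝓔' (hG₀A hg))
    · intro x hx
      obtain ⟨a', ha', b', hb', rfl⟩ := hfracA x hx
      let T : Subalgebra ↥(V.toSubring ⊓ K'.toSubring) Ω :=
        { (Subfield.closure ((K' : Set Ω) ∪ (G₀ : Set Ω))).toSubring with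
          algebraMap_mem' := fun c => Subfield.subset_closure (Or.inl c.2.2) }
      have hAT : A ≤ T := by
        rw [← hG₀]
        exact Algebra.adjoin_le fun g hg => Subfield.subset_closure (Or.inr hg)
      exact div_mem (show a' ∈ Subfield.closure ((K' : Set Ω) ∪ (G₀ : Set Ω)) from hAT ha')
        (show b' ∈ Subfield.closure ((K' : Set Ω) ∪ (G₀ : Set Ω)) from hAT hb')
  have hF₁𝓔' : F₁ ≤ 𝓔' := by
    refine Subfield.closure_le.mpr (Set.union_subset (hk₁K'.trans (hK'E'.trans hE'𝓔')) ?_)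
    intro w hw
    obtain ⟨a', ha', b', hb', -, rfl⟩ := hZbigA w (Finset.mem_coe.mp hw)
    exact div_mem (hA𝓔' ha') (hA𝓔' hb')
  have h𝓔'eq : F₁ ⊔ K' = 𝓔' := by
    refine le_antisymm (sup_le hF₁𝓔' (hK'E'.trans hE'𝓔')) ?_
    rw [← hA𝓔'cl]
    refine Subfield.closure_le.mpr (Set.union_subset (fun c hc => le_sup_right (α := Subfield Ω) hc) ?_)
    intro g hg
    exact (le_sup_left : F₁ ≤ F₁ ⊔ K') (hZbigF₁ (by simp [Finset.mem_coe.mp hg, Zbig]))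
  have hSU : IsSmoothlyUniformizableIn ↥(V.toSubring ⊓ K'.toSubring) V (F₁ ⊔ K') (Zbig : Set Ω) := by
    rw [h𝓔'eq]
    exact ⟨A, hAV, hA𝓔', hfpA, hfracA, hsmA, fun w hw => hZbigA w (Finset.mem_coe.mp hw)⟩
  obtain ⟨M, hk₁M, hMK', hfgM, hSUM⟩ := KnafKuhlmann2009_Prop34_2_holds Ω V k₁ F₁ K' hk₁F₁ hk₁K'
    hK'alg₁ Zbig hZbigV ⟨Zbig, subset_rfl, rfl⟩ hSU
  -- Step 3: `𝓔 := F₁.M`, `𝒦 := M`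
  have hKM : K ≤ M := hKk₁.trans hk₁M
  have hEF₁ : E ≤ F₁ := by
    rw [← hgE]
    refine Subfield.closure_le.mpr (Set.union_subset (hKk₁.trans hk₁F₁) fun g hg => ?_)
    exact hZbigF₁ (by simp [Zbig, Zg, Finset.mem_coe.mp hg])
  obtain ⟨sM, hsM⟩ : FGOver K M := (fgOver_closure K Z').trans hfgM
  have hsMM : (sM : Set Ω) ⊆ M := fun x hx => hsM ▸ Subfield.subset_closure (Or.inr hx)
  have hMalgK : ∀ x ∈ M, IsSeparable K x := fun x hx =>
    (mem_toSubfield_separableClosure_iff K).mp (hMK' hx)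
  obtain ⟨A₁, hA₁V, hA₁𝓔, hfp₁, hfrac₁, hsm₁, hZbig₁⟩ := hSUM
  refine ⟨F₁ ⊔ M, M, hEF₁.trans le_sup_left, hKM, le_sup_right, ?_, ?_, A₁, hA₁V, hA₁𝓔, hfp₁,
    hfrac₁, hsm₁, fun z hz => ?_⟩
  · -- finite separable over `E`
    refine ⟨Z' ∪ Zbig ∪ sM, fun x hx => ?_, ?_⟩
    · rcases Finset.mem_union.mp hx with hx | hx
      · rcases Finset.mem_union.mp hx with hx | hx
        · exact isSeparable_of_subfield_le hKE
            ((mem_toSubfield_separableClosure_iff K).mp (hZ'K' (Finset.mem_coe.mpr hx)))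
        · exact isSeparable_of_finiteSeparableOver_sup_separableClosure hKE hfinsep'
            (hF₁𝓔' (hZbigF₁ (Finset.mem_coe.mpr hx)))
      · exact isSeparable_of_subfield_le hKE (hMalgK x (hsMM (Finset.mem_coe.mpr hx)))
    · apply le_antisymm
      · refine Subfield.closure_le.mpr (Set.union_subset (hEF₁.trans le_sup_left) fun x hx => ?_)
        rcases Finset.mem_union.mp hx with hx | hx
        · rcases Finset.mem_union.mp hx with hx | hx
          · exact (le_sup_left : F₁ ≤ F₁ ⊔ M) (hk₁F₁ (hZ'k₁ (Finset.mem_coe.mpr hx)))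
          · exact (le_sup_left : F₁ ≤ F₁ ⊔ M) (hZbigF₁ (Finset.mem_coe.mpr hx))
        · exact (le_sup_right : M ≤ F₁ ⊔ M) (hsMM (Finset.mem_coe.mpr hx))
      · have hKW : K ≤ Subfield.closure ((E : Set Ω) ∪ ((Z' ∪ Zbig ∪ sM : Finset Ω) : Set Ω)) :=
          fun c hc => Subfield.subset_closure (Or.inl (hKE hc))
        refine sup_le ?_ ?_
        · refine Subfield.closure_le.mpr (Set.union_subset ?_ fun x hx => ?_)
          · refine Subfield.closure_le.mpr (Set.union_subset hKW fun x hx => ?_)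
            exact Subfield.subset_closure (Or.inr (by simp [Finset.mem_coe.mp hx]))
          · exact Subfield.subset_closure (Or.inr (by simp [Finset.mem_coe.mp hx]))
        · rw [← hsM]
          refine Subfield.closure_le.mpr (Set.union_subset hKW fun x hx => ?_)
          exact Subfield.subset_closure (Or.inr (by simp [Finset.mem_coe.mp hx]))
  · exact ⟨sM, fun x hx => (hMalgK x (hsMM hx)).isIntegral.isAlgebraic, hsM⟩
  · have hzZ : z ∈ Zg := Finset.mem_union_left _ hz
    have hu : a z hzZ / b z hzZ ∈ (Zbig : Set Ω) := by
      have : a z hzZ / b z hzZ ∈ U := Finset.mem_image.mpr ⟨⟨z, hzZ⟩, Finset.mem_attach _ _, rfl⟩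
      simp [Zbig, this]
    obtain ⟨a₁, ha₁, b₁, hb₁, hvb₁, hu₁⟩ := hZbig₁ _ hu
    have hva₁ : V.valuation a₁ = 1 := by
      have h := congrArg V.valuation hu₁
      rw [map_div₀, map_div₀, hva z hzZ, hvb z hzZ, hvb₁, div_one, div_one] at h
      exact h.symm
    have hz'Z' : z' z hzZ ∈ Z' := Finset.mem_image.mpr ⟨⟨z, hzZ⟩, Finset.mem_attach _ _, rfl⟩
    refine ⟨a₁, ha₁, b₁, hb₁, z' z hzZ, hk₁M (hZ'k₁ (Finset.mem_coe.mpr hz'Z')), hz'V z hzZ, hva₁,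
      hvb₁, ?_⟩
    rw [← hu₁]
    exact hzab z hzZ

/-- **Knaf–Kuhlmann 2009, Thm. 1.1 with `Z = ∅`** in the vocabulary of `IsSmoothlyUniformizableIn`,
from Prop. 3.10. [cite: KnafKuhlmann2009, Thm. 1.1] -/
theorem KnafKuhlmann2009_Prop310_sepClosed.thm11 (h310 : KnafKuhlmann2009_Prop310_sepClosed.{u}) :
    KnafKuhlmann2009_Thm11.{u} :=
  KnafKuhlmann2009_Thm11.of_prop310 h310

end Literature.AlgebraicGeometry.Resolution

end
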